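import Literature.Probability.Percolation.SlabRSWGluingExtAt
import HarnessLib

/-!
# Newman–Tassion–Wu 2017, §3.2 — the gluing lemma with a SEGMENT target and a TOP extension
# (`S ⊊ R`, `C` far from `S`): setting, plain surgery and direct gluing from PORT DATA

Topic: `Literature/Probability/Percolation`. The high-probability regime of NTW's gluing lemma in the
tree (`glue_highProb_of_gadgets_entR`, lead GEN 37) needs `C` far from `S` (Fact 1 in general
position) and a located gadget at every entry cell. The second gluing (3.29) of the proof of
Prop. 3.9 (1) cannot be obtained from a FULL-SIDE target in that regime (the `C`-path enters `S`
through the side carrying `B`); NTW's own (3.29) uses a SEGMENT target (`Γ : L(R') → Y`,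
`σ : R(R') → X`, `X`, `Y` interleaved bottom segments). This file sets up the corresponding two-domain
geometry — after a rotation: `S = [a,b] × [c,d] ⊆ R = [a,b] × [c,d']` (a pure top extension),
target `B = {b} × [y₁, y₂]` a segment of the right side of `S` well below its top-right corner,
`A ⊆ S`, `C ⊆ R` — and re-runs, from PORT DATA at a prescribed entry cell, p2's plain surgery
(`exists_surgery_noB`, the cleared box meets no cell of `B`; here the box may stick out above the row
`d`: trunk in `box ∩ S`, branch in `box ∩ R` as in the lead's `exists_surgery_ext_at`) and the direct
gluing near `A`.

* `SegExtSetup`, `SegExtSetup.Q`, the boxes `Dbox` / `DS` / `DG`, the radius `rad`;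
* `exists_surgery_segExt_at`, `exists_directGlue_A_segExt_at`.

The `B`-near surgery, the gadget supply and the high-probability GL are in `SlabRSWGluingSegExtB.lean`.

## Sources

* C. M. Newman, V. Tassion, W. Wu, *Critical percolation and the minimal spanning tree in slabs*,
  Comm. Pure Appl. Math. 70 (2017), arXiv:1512.09107: §3.2, Theorems 3.6–3.7 and the proof of
  Theorem 3.7, steps (1)–(3), Fact 2; §3.3, proof of Proposition 3.9, (3.29) [NewmanTassionWu2017].
-/

noncomputable section

namespace Literature.Probability.Percolation

open MeasureTheory LatticeModels SimpleGraph

namespace NTW17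

variable {k : ℕ}

/-! ## The setting -/

/-- **GL with a segment target and a top extension**: `S = [a,b] × [c,d]` (at least four columns and
rows) inside `R = [a,b] × [c,d']` (`d ≤ d'`), target `B = {b} × [y₁, y₂]` with `c ≤ y₁ < y₂ ≤ d`,
`A ⊆ S`, `C ⊆ R`. [cite: NewmanTassionWu2017, §3.2 (Theorem 3.7, the sets S, R, A, B, C); §3.3 (proof of Proposition 3.9, (3.29))] -/
structure SegExtSetup where
  /-- left column of `S` and `R` -/
  a : ℤ
  /-- right column of `S` and `R` (the side carrying `B`) -/
  b : ℤ
  /-- bottom row of `S` and `R` -/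
  c : ℤ
  /-- top row of `S` -/
  d : ℤ
  /-- top row of `R` -/
  d' : ℤ
  /-- bottom end of `B` -/
  y₁ : ℤ
  /-- top end of `B` -/
  y₂ : ℤ
  /-- the set to be reached -/
  A : Set (ℤ × ℤ)
  /-- the set to be glued -/
  C : Set (ℤ × ℤ)
  hab : a + 3 ≤ b
  hcd : c + 3 ≤ d
  hdd' : d ≤ d'
  hy₁ : c ≤ y₁
  hy : y₁ < y₂
  hy₂ : y₂ ≤ d
  hA : A ⊆ boxR a b c d
  hC : C ⊆ boxR a b c d'

namespace SegExtSetup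

variable (W : SegExtSetup)

/-- The rectangle `S` (domain of the minimal path). [cite: NewmanTassionWu2017, §3.2 (Theorem 3.7, S)] -/
def S : Set (ℤ × ℤ) := boxR W.a W.b W.c W.d

/-- The rectangle `R ⊇ S` (domain of the glued connection). [cite: NewmanTassionWu2017, §3.2 (Theorem 3.7, R)] -/
def R : Set (ℤ × ℤ) := boxR W.a W.b W.c W.d'

/-- The target segment `B = {b} × [y₁, y₂]`. [cite: NewmanTassionWu2017, §3.2 (Theorem 3.7, B)] -/
def B : Set (ℤ × ℤ) := {z | z.1 = W.b ∧ W.y₁ ≤ z.2 ∧ z.2 ≤ W.y₂}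

/-- `S ⊆ R`. [cite: NewmanTassionWu2017, §3.2 (Theorem 3.7)] -/
theorem S_subset_R : W.S ⊆ W.R := by
  intro z hz
  rw [S, mem_boxR_iff] at hz
  rw [R, mem_boxR_iff]
  have := W.hdd'
  omega

/-- The gluing data `(S, R, A, B, C)`. [cite: NewmanTassionWu2017, §3.2 (Theorem 3.7)] -/
def Q : GlueData := ⟨W.S, W.R, W.A, W.B, W.C, W.S_subset_R, boxR_finite _ _ _ _, boxR_finite _ _ _ _⟩

/-- The cleared box `(z + B_r) ∩ R`. [cite: NewmanTassionWu2017, §3.2 (proof of Theorem 3.7, the ball B_{r+2}(z))] -/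
def Dbox (z : ℤ × ℤ) (r : ℕ) : Set (ℤ × ℤ) :=
  boxR (max W.a (z.1 - r)) (min W.b (z.1 + r)) (max W.c (z.2 - r)) (min W.d' (z.2 + r))

/-- The trunk box `(z + B_r) ∩ S`. [cite: NewmanTassionWu2017, §3.2 (proof of Theorem 3.7, the ball B_{r+1}(z) ∩ S)] -/
def DS (z : ℤ × ℤ) (r : ℕ) : Set (ℤ × ℤ) :=
  boxR (max W.a (z.1 - r)) (min W.b (z.1 + r)) (max W.c (z.2 - r)) (min W.d (z.2 + r))

/-- The trunk box minus the column `x = b`: `(z + B_r) ∩ S ∖ {x = b}`. [cite: NewmanTassionWu2017, §3.2 (proof of Theorem 3.7)] -/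
def DG (z : ℤ × ℤ) (r : ℕ) : Set (ℤ × ℤ) :=
  boxR (max W.a (z.1 - r)) (min (W.b - 1) (z.1 + r)) (max W.c (z.2 - r)) (min W.d (z.2 + r))

/-- `B` meets the box of radius `r` around `z`. [cite: NewmanTassionWu2017, §3.2 (proof of Theorem 3.7)] -/
def Bnear (z : ℤ × ℤ) (r : ℕ) : Prop := W.b ≤ z.1 + r ∧ W.y₁ ≤ z.2 + r ∧ z.2 - r ≤ W.y₂

/-- `B` meets the box of radius `r` around `z` in at least two rows. [cite: NewmanTassionWu2017, §3.2 (proof of Theorem 3.7)] -/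
def Btwo (z : ℤ × ℤ) (r : ℕ) : Prop := W.b ≤ z.1 + r ∧ W.y₁ + 1 ≤ z.2 + r ∧ z.2 - r + 1 ≤ W.y₂

/-- **The radius of the cleared box**: `ρ + 3` above the row `d`; otherwise `ρ + 2`, enlarged to
`ρ + 3` when `B` meets the box of radius `ρ + 2` in exactly one row (p2's `SegSetup.R`).
[cite: NewmanTassionWu2017, §3.2 (proof of Theorem 3.7, the radius r)] -/
def rad (ρ : ℕ) (z : ℤ × ℤ) : ℕ :=
  open scoped Classical in
  if W.d < z.2 then ρ + 3 else if W.Bnear z (ρ + 2) ∧ ¬W.Btwo z (ρ + 2) then ρ + 3 else ρ + 2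

variable {W}

/-- Membership in `S`. [cite: NewmanTassionWu2017, §3.2 (Theorem 3.7, S)] -/
theorem mem_S_iff {z : ℤ × ℤ} : z ∈ W.S ↔ W.a ≤ z.1 ∧ z.1 ≤ W.b ∧ W.c ≤ z.2 ∧ z.2 ≤ W.d :=
  mem_boxR_iff z

/-- Membership in `R`. [cite: NewmanTassionWu2017, §3.2 (Theorem 3.7, R)] -/
theorem mem_R_iff {z : ℤ × ℤ} : z ∈ W.R ↔ W.a ≤ z.1 ∧ z.1 ≤ W.b ∧ W.c ≤ z.2 ∧ z.2 ≤ W.d' :=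
  mem_boxR_iff z

/-- Membership in `B`. [cite: NewmanTassionWu2017, §3.2 (Theorem 3.7, B)] -/
theorem mem_B_iff {z : ℤ × ℤ} : z ∈ W.B ↔ z.1 = W.b ∧ W.y₁ ≤ z.2 ∧ z.2 ≤ W.y₂ := Iff.rfl

/-- `B ⊆ S`. [cite: NewmanTassionWu2017, §3.2 (Theorem 3.7, B ⊆ ∂S)] -/
theorem B_subset_S : W.B ⊆ W.S := by
  intro z hz
  rw [mem_B_iff] at hz
  rw [mem_S_iff]
  have := W.hab; have := W.hy₁; have := W.hy₂
  omega

/-- Membership in `Dbox`. [cite: NewmanTassionWu2017, §3.2 (proof of Theorem 3.7)] -/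
theorem mem_Dbox_iff {z w : ℤ × ℤ} {r : ℕ} : w ∈ W.Dbox z r ↔ w ∈ W.R ∧ w ∈ sqBox z r := by
  rw [Dbox, mem_boxR_iff, mem_R_iff, mem_sqBox_iff']
  simp only [max_le_iff, le_min_iff]
  omega

/-- Membership in `DS`. [cite: NewmanTassionWu2017, §3.2 (proof of Theorem 3.7)] -/
theorem mem_DS_iff {z w : ℤ × ℤ} {r : ℕ} : w ∈ W.DS z r ↔ w ∈ W.S ∧ w ∈ sqBox z r := by
  rw [DS, mem_boxR_iff, mem_S_iff, mem_sqBox_iff']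
  simp only [max_le_iff, le_min_iff]
  omega

/-- Membership in `DG`. [cite: NewmanTassionWu2017, §3.2 (proof of Theorem 3.7)] -/
theorem mem_DG_iff {z w : ℤ × ℤ} {r : ℕ} : w ∈ W.DG z r ↔ w ∈ W.S ∧ w ∈ sqBox z r ∧ w.1 ≠ W.b := by
  rw [DG, mem_boxR_iff, mem_S_iff, mem_sqBox_iff']
  simp only [max_le_iff, le_min_iff]
  omega

/-- `Dbox ⊆ R`. [cite: NewmanTassionWu2017, §3.2 (proof of Theorem 3.7)] -/
theorem Dbox_subset_R (z : ℤ × ℤ) (r : ℕ) : W.Dbox z r ⊆ W.R := fun _ h => (mem_Dbox_iff.1 h).1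

/-- `Dbox ⊆ z + B_r`. [cite: NewmanTassionWu2017, §3.2 (proof of Theorem 3.7)] -/
theorem Dbox_subset_sqBox (z : ℤ × ℤ) (r : ℕ) : W.Dbox z r ⊆ sqBox z r := fun _ h => (mem_Dbox_iff.1 h).2

/-- `DS ⊆ Dbox`. [cite: NewmanTassionWu2017, §3.2 (proof of Theorem 3.7)] -/
theorem DS_subset_Dbox (z : ℤ × ℤ) (r : ℕ) : W.DS z r ⊆ W.Dbox z r := fun _ h =>
  mem_Dbox_iff.2 ⟨W.S_subset_R (mem_DS_iff.1 h).1, (mem_DS_iff.1 h).2⟩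

/-- `DS ⊆ S`. [cite: NewmanTassionWu2017, §3.2 (proof of Theorem 3.7)] -/
theorem DS_subset_S (z : ℤ × ℤ) (r : ℕ) : W.DS z r ⊆ W.S := fun _ h => (mem_DS_iff.1 h).1

/-- `DG ⊆ DS`. [cite: NewmanTassionWu2017, §3.2 (proof of Theorem 3.7)] -/
theorem DG_subset_DS (z : ℤ × ℤ) (r : ℕ) : W.DG z r ⊆ W.DS z r := fun _ h =>
  mem_DS_iff.2 ⟨(mem_DG_iff.1 h).1, (mem_DG_iff.1 h).2.1⟩

/-- `DG` avoids `B`. [cite: NewmanTassionWu2017, §3.2 (proof of Theorem 3.7)] -/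
theorem DG_disjoint_B {z w : ℤ × ℤ} {r : ℕ} (h : w ∈ W.DG z r) : w ∉ W.B := fun hB =>
  (mem_DG_iff.1 h).2.2 hB.1

/-- A cell of `B` in the box of radius `r` around `z` witnesses `Bnear`.
[cite: NewmanTassionWu2017, §3.2 (proof of Theorem 3.7)] -/
theorem bnear_of_mem {z w : ℤ × ℤ} {r : ℕ} (hw : w ∈ W.B) (hwz : w ∈ sqBox z r) : W.Bnear z r := by
  rw [mem_B_iff] at hw
  rw [mem_sqBox_iff'] at hwz
  exact ⟨by omega, by omega, by omega⟩

/-- The radius is `ρ + 2` or `ρ + 3`. [cite: NewmanTassionWu2017, §3.2 (proof of Theorem 3.7)] -/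
theorem rad_bounds (ρ : ℕ) (z : ℤ × ℤ) : ρ + 2 ≤ W.rad ρ z ∧ W.rad ρ z ≤ ρ + 3 := by
  unfold rad; split_ifs <;> omega

/-- Above the row `d` the radius is `ρ + 3`. [cite: NewmanTassionWu2017, §3.2 (proof of Theorem 3.7)] -/
theorem rad_eq_of_lt {ρ : ℕ} {z : ℤ × ℤ} (h : W.d < z.2) : W.rad ρ z = ρ + 3 := by
  unfold rad; rw [if_pos h]

/-- **If `B` meets the cleared box, it meets it in at least two rows** (for centres not above the row
`d`). [cite: NewmanTassionWu2017, §3.2 (proof of Theorem 3.7)] -/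
theorem btwo_of_bnear {ρ : ℕ} {z : ℤ × ℤ} (hz : z.2 ≤ W.d) (h : W.Bnear z (W.rad ρ z)) :
    W.Btwo z (W.rad ρ z) := by
  classical
  have hy := W.hy
  unfold rad at h ⊢
  rw [if_neg (not_lt.2 hz)] at h ⊢
  by_cases hc : W.Bnear z (ρ + 2) ∧ ¬W.Btwo z (ρ + 2)
  · rw [if_pos hc] at h ⊢
    obtain ⟨⟨h1, h2, h2'⟩, h3⟩ := hc
    simp only [Btwo, Bnear, not_and, not_le] at h3 h ⊢
    push_cast at h1 h2 h2' h3 h ⊢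
    omega
  · rw [if_neg hc] at h ⊢
    rw [not_and_or, not_not] at hc
    rcases hc with hc | hc
    · exact absurd h hc
    · exact hc

/-- `Q.S = S`. [cite: NewmanTassionWu2017, §3.2 (Theorem 3.7)] -/
theorem Q_S : W.Q.S = W.S := rfl
/-- `Q.R = R`. [cite: NewmanTassionWu2017, §3.2 (Theorem 3.7)] -/
theorem Q_R : W.Q.R = W.R := rfl
/-- `Q.A = A`. [cite: NewmanTassionWu2017, §3.2 (Theorem 3.7)] -/
theorem Q_A : W.Q.A = W.A := rfl
/-- `Q.B = B`. [cite: NewmanTassionWu2017, §3.2 (Theorem 3.7)] -/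
theorem Q_B : W.Q.B = W.B := rfl
/-- `Q.C = C`. [cite: NewmanTassionWu2017, §3.2 (Theorem 3.7)] -/
theorem Q_C : W.Q.C = W.C := rfl

end SegExtSetup

/-! ## Where a contact point can be -/

section ContactPoint

variable {W : SegExtSetup} {ω : BondConfig (slab 3 k)} {ρ : ℕ}

/-- A point of `R` within `ρ` of a vertex of `Γ ⊆ S̄` satisfies `a ≤ z.1 ≤ b`, `c ≤ z.2 ≤ d + ρ`.
[cite: NewmanTassionWu2017, §3.2 (proof of Theorem 3.7, step (1))] -/
theorem SegExtSetup.contact_bounds (hA : ω ∈ W.Q.evAB k) {z : ℤ × ℤ} (hzR : z ∈ W.R)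
    (hnear : Near k (W.Q.γ k ω) ρ z) :
    W.a ≤ z.1 ∧ z.1 ≤ W.b ∧ W.c ≤ z.2 ∧ z.2 ≤ W.d + ρ := by
  obtain ⟨hγO, -⟩ := W.Q.γ_spec hA
  obtain ⟨g, hg, hz⟩ := hnear
  have hgS : planar k g ∈ W.S := hγO.subset g hg
  rw [SegExtSetup.mem_S_iff] at hgS
  rw [SegExtSetup.mem_R_iff] at hzR
  rw [mem_sqBox_iff'] at hz
  omega

end ContactPoint

/-! ## The plain surgery from port data: the cleared box meets no cell of `B` -/

section Plain

variable {W : SegExtSetup} {ω : BondConfig (slab 3 k)} {ρ : ℕ}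

/-- **The plain surgery at a prescribed entry cell, from port data** (segment target, top
extension): given `v ∈ R̄` within `ρ` of `Γ̄`, a lattice neighbour `u` of `v`, an `ω`-open
self-avoiding path from `c₀ ∈ C̄` to `u` inside `R̄` off the `ρ`-neighbourhood of `Γ̄`, no cell of `A`
or `C` within `ρ + 3` of `z = planar v`, and the cleared box `(z + B_{rad}) ∩ R` meeting no cell of
`B`, there is a surgery whose cleared set is inside `z + B_{ρ+3}` (trunk in the box `∩ S`, branch in
the box `∩ R`). [cite: NewmanTassionWu2017, §3.2 (proof of Theorem 3.7, steps (1)–(3); Fact 2, ω^{(z)} for z ∈ U(ω))] -/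
theorem exists_surgery_segExt_at (hk : 1 ≤ k) (hρ : 2 ≤ ρ) (hω : ω ⊆ (slabGraph 3 k).edgeSet)
    (hX : ω ∈ W.Q.evX k) {c₀ u v : slab 3 k} {L : List (slab 3 k)} (hc₀ : c₀ ∈ slabLift k W.C)
    (hL : IsOSAP k ω (slabLift k W.R ∩ {x | ¬Near k (W.Q.γ k ω) ρ (planar k x)}) {c₀} {u} L)
    (huv : (slabGraph 3 k).Adj u v) (hvR : v ∈ slabLift k W.R)
    (hnear : Near k (W.Q.γ k ω) ρ (planar k v))
    (hnA : ∀ a' ∈ W.A, a' ∉ sqBox (planar k v) (ρ + 3))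
    (hnC : ∀ c' ∈ W.C, c' ∉ sqBox (planar k v) (ρ + 3))
    (hnB : ¬W.Bnear (planar k v) (W.rad ρ (planar k v))) :
    ∃ sx : W.Q.Surgery k ω, sx.D ⊆ sqBox (planar k v) (ρ + 3) := by
  have hA : ω ∈ W.Q.evAB k := hX.1
  obtain ⟨hγO, -⟩ := W.Q.γ_spec hA
  set z := planar k v with hzdef
  obtain ⟨hR1, hR2⟩ := SegExtSetup.rad_bounds (W := W) ρ z
  set r : ℕ := W.rad ρ z with hrdef
  set D := W.Dbox z r with hDdef
  set K := W.DS z r with hKdef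
  have hzR : z ∈ W.R := hvR
  obtain ⟨hz1, hz2, hz3, hz4⟩ := SegExtSetup.contact_bounds hA hzR hnear
  have hzR' := hzR
  rw [SegExtSetup.mem_R_iff] at hzR'
  have hab := W.hab; have hcd := W.hcd; have hdd' := W.hdd'
  have hDz : D ⊆ sqBox z (ρ + 3) := (SegExtSetup.Dbox_subset_sqBox _ _).trans (sqBox_mono _ hR2)
  have hzD : z ∈ D := SegExtSetup.mem_Dbox_iff.2 ⟨hzR, mem_sqBox_self _ _⟩
  have hc₀D : planar k c₀ ∉ D := fun h => hnC _ hc₀ (hDz h)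
  have hDA : ∀ w ∈ D, w ∉ W.Q.A := fun w hw hwA => hnA w hwA (hDz hw)
  have hDB : ∀ w ∈ D, w ∉ W.Q.B := fun w hw hwB =>
    hnB (SegExtSetup.bnear_of_mem hwB (SegExtSetup.Dbox_subset_sqBox _ _ hw))
  have hKD : K ⊆ D := SegExtSetup.DS_subset_Dbox _ _
  -- the rows of the trunk box: at least four
  have hrows : max W.c (z.2 - (r : ℕ)) + 3 ≤ min W.d (z.2 + (r : ℕ)) := by
    by_cases hzd : W.d < z.2
    · have hr : r = ρ + 3 := SegExtSetup.rad_eq_of_lt hzd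
      simp only [max_add, le_min_iff, max_le_iff]
      rw [hr]; push_cast; omega
    · simp only [max_add, le_min_iff, max_le_iff]
      omega
  -- the port: the first entry of the far path into `D̄` (`u`, its last vertex, lies over `D`)
  have huL : u ∈ L := by
    have := hL.last_mem hL.ne_nil
    rw [Set.mem_singleton_iff] at this
    rw [← this]; exact List.getLast_mem _
  have huD : planar k u ∈ D := by
    refine SegExtSetup.mem_Dbox_iff.2 ⟨(hL.subset u huL).1, sqBox_mono _ (by omega : 1 ≤ r) ?_⟩
    exact planar_mem_sqBox_one_of_adj huv.symm
  have hheadL : L.head hL.ne_nil = c₀ := by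
    have := hL.head_mem hL.ne_nil
    rwa [Set.mem_singleton_iff] at this
  have hheadD : planar k (L.head hL.ne_nil) ∉ D := by rw [hheadL]; exact hc₀D
  obtain ⟨m, w', rest, hm, hLeq, hmD, hw'D, hedge, -, hmhead, hconn, -⟩ :=
    exists_entry (R := W.R) hL.chain hL.nodup (fun x hx => (hL.subset x hx).1) hL.ne_nil hheadD
      ⟨u, huL, huD⟩
  rw [hheadL] at hconn
  set q₁ := m.getLast hm with hq₁
  have hadj : (slabGraph 3 k).Adj w' q₁ := ((SimpleGraph.mem_edgeSet _).1 (hω hedge)).symm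
  have hq₁D : planar k q₁ ∉ D := hmD _ (List.getLast_mem hm)
  have hσ : ω ∈ openConnIn (slabLift k (W.Q.R \ D)) q₁ c₀ := openConnIn_reverse hconn
  have hw'L : w' ∈ L := by rw [hLeq]; simp
  have hw'far : ¬Near k (W.Q.γ k ω) ρ (planar k w') := (hL.subset w' hw'L).2
  -- two vertices of `γ` over `D`: `g₀` and its predecessor
  obtain ⟨g₀, hg₀, hz⟩ := hnear
  have hg₀z : planar k g₀ ∈ sqBox z ρ := GlueGeom.mem_sqBox_comm hz
  have hg₀h := ne_head_of_far_A (Q := W.Q) hA hz (by omega : ρ ≤ ρ + 3) hnA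
  obtain ⟨g₁, hg₁γ, hadj₀, hg₁ne, -⟩ := exists_pred hω hA hg₀ hg₀h
  have hg₀D : planar k g₀ ∈ D :=
    SegExtSetup.mem_Dbox_iff.2 ⟨W.S_subset_R (hγO.subset g₀ hg₀), sqBox_mono _ (by omega) hg₀z⟩
  have hg₁D : planar k g₁ ∈ D := by
    refine SegExtSetup.mem_Dbox_iff.2 ⟨W.S_subset_R (hγO.subset g₁ hg₁γ),
      sqBox_mono _ (by omega : ρ + 1 ≤ r) ?_⟩
    exact mem_sqBox_add hg₀z (planar_mem_sqBox_one_of_adj hadj₀.symm)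
  have htwo : ∃ x ∈ W.Q.γ k ω, ∃ y ∈ W.Q.γ k ω, x ≠ y ∧ planar k x ∈ D ∧ planar k y ∈ D :=
    ⟨g₁, hg₁γ, g₀, hg₀, hg₁ne, hg₁D, hg₀D⟩
  -- a vertex of `γ` over `D` lies over the trunk box
  have hγK : ∀ x ∈ W.Q.γ k ω, planar k x ∈ D → planar k x ∈ K := fun x hx hxD =>
    SegExtSetup.mem_DS_iff.2 ⟨hγO.subset x hx, SegExtSetup.Dbox_subset_sqBox _ _ hxD⟩
  -- routing: trunk in `K`, branch in `D`
  have hroute : ∀ E₁ E₂ : slab 3 k, E₁ ∈ W.Q.γ k ω → E₂ ∈ W.Q.γ k ω → E₁ ≠ E₂ →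
      planar k E₁ ∈ D → planar k E₂ ∈ D → ∃ Lr Br c, RouteSpec k K D E₁ E₂ w' Lr Br c := by
    intro E₁ E₂ hE₁ hE₂ hne hE₁D hE₂D
    have h1 : ¬Near k (W.Q.γ k ω) 0 (planar k w') := fun hn => hw'far (hn.mono (by omega))
    exact exists_route (xL := max W.a (z.1 - (r : ℕ)))
      (xR' := min W.b (z.1 + (r : ℕ))) (xR := min W.b (z.1 + (r : ℕ)))
      (rB := max W.c (z.2 - (r : ℕ))) (rP := min W.d (z.2 + (r : ℕ))) (rT := min W.d' (z.2 + (r : ℕ)))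
      hk (by omega) le_rfl hrows (by omega) (hγK E₁ hE₁ hE₁D) (hγK E₂ hE₂ hE₂D)
      hw'D hne (ne_planar_of_not_near h1 hE₁).symm (ne_planar_of_not_near h1 hE₂).symm
  obtain ⟨sx, hsx⟩ := exists_surgery_of_route (Q := W.Q) hX (D := D) (Dt := K)
    (SegExtSetup.Dbox_subset_R _ _) hDA hDB hKD (SegExtSetup.DS_subset_S _ _)
    htwo hadj hq₁D hc₀ hσ hroute
  exact ⟨sx, hsx ▸ hDz⟩

end Plain

/-! ## Direct gluing near `A` from port data -/

section AtA

variable {W : SegExtSetup} {ω : BondConfig (slab 3 k)} {ρ : ℕ}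

/-- **Direct gluing near `A` at a prescribed entry cell, from port data** (segment target, top
extension): if a cell of `A` is within `ρ + 3` of `z = planar v`, the far path from `c₀ ∈ C̄` to `u`
(a lattice neighbour of `v`) enters the box `(z + B_{ρ+3}) ∩ R`, and the `C`-cluster is glued to `Ā`
inside it. [cite: NewmanTassionWu2017, §3.2 (proof of Theorem 3.7, steps (2)–(3), near A; Fact 2, ω^{(z)})] -/
theorem exists_directGlue_A_segExt_at (hω : ω ⊆ (slabGraph 3 k).edgeSet) (hX : ω ∈ W.Q.evX k)
    (hsep : ∀ a' ∈ W.A, ∀ c' ∈ W.C, c' ∉ sqBox a' (4 * ρ + 8))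
    {c₀ u v : slab 3 k} {L : List (slab 3 k)} (hc₀ : c₀ ∈ slabLift k W.C)
    (hL : IsOSAP k ω (slabLift k W.R ∩ {x | ¬Near k (W.Q.γ k ω) ρ (planar k x)}) {c₀} {u} L)
    (huv : (slabGraph 3 k).Adj u v)
    (hA' : ∃ a' ∈ W.A, a' ∈ sqBox (planar k v) (ρ + 3)) :
    ∃ dg : DirectGlue k W.R W.C W.A ω, dg.D ⊆ sqBox (planar k v) (ρ + 3) := by
  set z := planar k v with hzdef
  set D := W.Dbox z (ρ + 3) with hDdef
  obtain ⟨a', ha', ha'z⟩ := hA'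
  have hDC : ∀ w ∈ D, w ∉ W.C := by
    intro w hw hwC
    have hwz := SegExtSetup.Dbox_subset_sqBox _ _ hw
    have : w ∈ sqBox a' ((ρ + 3) + (ρ + 3)) := mem_sqBox_add (GlueGeom.mem_sqBox_comm ha'z) hwz
    exact hsep a' ha' w hwC (sqBox_mono _ (by omega) this)
  have hc₀D : planar k c₀ ∉ D := fun h => hDC _ h hc₀
  have huL : u ∈ L := by
    have := hL.last_mem hL.ne_nil
    rw [Set.mem_singleton_iff] at this
    rw [← this]; exact List.getLast_mem _
  have huD : planar k u ∈ D := by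
    refine SegExtSetup.mem_Dbox_iff.2 ⟨(hL.subset u huL).1, sqBox_mono _ (by omega : 1 ≤ ρ + 3) ?_⟩
    exact planar_mem_sqBox_one_of_adj huv.symm
  have hheadL : L.head hL.ne_nil = c₀ := by
    have := hL.head_mem hL.ne_nil
    rwa [Set.mem_singleton_iff] at this
  have hheadD : planar k (L.head hL.ne_nil) ∉ D := by rw [hheadL]; exact hc₀D
  obtain ⟨m, w', rest, hm, hLeq, hmD, hw'D, hedge, -, -, hconn, -⟩ :=
    exists_entry (R := W.R) hL.chain hL.nodup (fun x hx => (hL.subset x hx).1) hL.ne_nil hheadD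
      ⟨u, huL, huD⟩
  rw [hheadL] at hconn
  have hadj : (slabGraph 3 k).Adj (m.getLast hm) w' := (SimpleGraph.mem_edgeSet _).1 (hω hedge)
  have hw'L : w' ∈ L := by rw [hLeq]; simp
  -- `w'` is joined to `c₀ ∈ C̄` inside `R̄`: it cannot lie over `A` (else `C ⟷^R A`)
  have hw'A : planar k w' ∉ W.A := by
    intro hA'
    have hj := hL.openConnIn_of_mem hw'L
    rw [hheadL] at hj
    exact hX.2 ⟨c₀, hc₀, w', hA', openConnIn_mono (Set.inter_subset_left) _ _ hj⟩
  have ha'D : a' ∈ D := SegExtSetup.mem_Dbox_iff.2 ⟨W.S_subset_R (W.hA ha'), ha'z⟩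
  obtain ⟨dg, hdg⟩ := exists_directGlue (R := W.R) (Src := W.C) (Tg := W.A)
    (SegExtSetup.Dbox_subset_R _ _) hDC hc₀ (hmD _ (List.getLast_mem hm)) hconn hadj hw'D hw'A ha'D ha'
  exact ⟨dg, hdg ▸ SegExtSetup.Dbox_subset_sqBox _ _⟩

end AtA

end NTW17

end Literature.Probability.Percolation

end
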